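import Mathlib
import Summits.QuantumAdvantage.QuantumAdvantage.Theorems.MobiusLadderQuadraticDigitPhasesStubOneCutKataiDigits

/-!
# Word decay ⇒ Walsh–dilation decay on intervals (transfer matrices + dyadic blocks)

The stub `stub_dwdOfWords` of the crux `MobiusLadder.QuadraticDigitPhases`
(stmt-QuantumAdvantage-1391), line `Sketch`, with its (elementary, folklore) lemmas.

For `T = Σ_j t_j 2^j` the schoolbook carries of `T ↦ pT` are `r₀ = 0`,
`r_{j+1} = ⌊(p t_j + r_j)/2⌋`, so that `r_j = ⌊p T / 2^j⌋` for `T < 2^j` and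
`bit_j(pT) = (p t_j + r_j) mod 2` (`carry_succ`, `sign_bit_succ`).  Hence `2^i` times the row at the
initial state `(0,0)` of a product of pair-carry transfer matrices `M_{ℓ₀} ⋯ M_{ℓ_{i-1}}` is the
Walsh–dilation sum over `T < 2^i` restricted to the carry fibre (`two_pow_mul_row_prod`); an
aligned dyadic block of length `2^i` therefore costs at most `2^i ‖e₀₀ M_{ℓ₀} ⋯ M_{ℓ_{i-1}}‖₁`
(`abs_block_le`: the positions `≥ i` only read the carries); and `Ico a b ⊆ [0, 2^c)` is the
difference of two prefixes, each covered by aligned dyadic blocks, one per length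
(`abs_sum_Ico_le_cover`).  Blocks shorter than `2^{i₀}` cost `≤ 2^{i₀+1}` in total, longer ones
have prefix words with `≥ w'` twisted letters, whence `stub_dwdOfWords`.
-/

set_option linter.dupNamespace false -- D-0017: single-problem summit ⇒ QuantumAdvantage.QuantumAdvantage by design

namespace Summit.QuantumAdvantage.QuantumAdvantage.Theorems.MobiusLadderQuadraticDigitPhasesStubDwdOfWords

open Finset MobiusLadderQuadraticDigitPhasesStubOneCutKatai

/-- The carry after `i+1` digits: `⌊p (2^i t + T) / 2^{i+1}⌋ = ⌊(p t + ⌊p T/2^i⌋)/2⌋`. -/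
theorem carry_succ (p i t T : ℕ) :
    p * (2 ^ i * t + T) / 2 ^ (i + 1) = (p * t + p * T / 2 ^ i) / 2 := by
  have h2 : 0 < 2 ^ i := Nat.two_pow_pos i
  rw [mul_block_eq, pow_succ, ← Nat.div_div_eq_div_mul, Nat.mul_add_div h2,
    Nat.div_eq_of_lt (Nat.mod_lt _ h2), add_zero]

/-- The output bit at position `i`: `χ_i(p (2^i t + T)) = (-1)^{(p t + ⌊p T/2^i⌋) mod 2}`. -/
theorem sign_bit_succ (p i t T : ℕ) :
    (if Nat.testBit (p * (2 ^ i * t + T)) i then (-1 : ℝ) else 1) =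
      (-1 : ℝ) ^ ((p * t + p * T / 2 ^ i) % 2) := by
  rw [testBit_mul_block]
  simp only [lt_irrefl, if_false, Nat.sub_self, Nat.testBit_zero]
  rcases Nat.mod_two_eq_zero_or_one (p * t + p * T / 2 ^ i) with h | h <;> simp [h]

/-- The carries of `T < 2^i` are states: `⌊p T / 2^i⌋ < p`. -/
theorem carry_lt {p i T : ℕ} (hp : 0 < p) (hT : T ∈ range (2 ^ i)) : p * T / 2 ^ i < p :=
  (Nat.div_lt_iff_lt_mul (Nat.two_pow_pos i)).2
    (Nat.mul_lt_mul_of_pos_left (Finset.mem_range.mp hT) hp)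

/-- A sum over the states against the indicator of one carry pair picks out that state. -/
theorem sum_ite_state {p q m m' : ℕ} (hm : m < p) (hm' : m' < q) (c : ℝ)
    (φ : Fin p × Fin q → ℝ) :
    ∑ z : Fin p × Fin q, (if (z.1 : ℕ) = m ∧ (z.2 : ℕ) = m' then c else 0) * φ z =
      c * φ (⟨m, hm⟩, ⟨m', hm'⟩) := by
  rw [Finset.sum_eq_single (⟨m, hm⟩, ⟨m', hm'⟩) (fun z _ hz => by
      rw [if_neg fun h => hz (Prod.ext (Fin.ext h.1) (Fin.ext h.2)), zero_mul])
    (fun h => absurd (Finset.mem_univ _) h), if_pos ⟨rfl, rfl⟩]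

/-- SEMANTICS of the pair-carry transfer matrices: `2^i (e₀₀ M_{ℓ₀} ⋯ M_{ℓ_{i-1}})_y` is the
Walsh–dilation sum over `T < 2^i` (letters `ℓ_j = (α j, β j)` twist the bits `j` of `pT`, `qT`)
restricted to the carry fibre `(⌊pT/2^i⌋, ⌊qT/2^i⌋) = y`. -/
theorem two_pow_mul_row_prod {p q : ℕ} (hp : 0 < p) (hq : 0 < q)
    (M : Bool × Bool → Matrix (Fin p × Fin q) (Fin p × Fin q) ℝ)
    (hM : M = fun ab : Bool × Bool => (Matrix.of fun (x y : Fin p × Fin q) =>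
      ∑ t ∈ ({0, 1} : Finset ℕ),
        if (y.1 : ℕ) = (p * t + x.1) / 2 ∧ (y.2 : ℕ) = (q * t + x.2) / 2 then
          (1 / 2 : ℝ) * (if ab.1 then (-1 : ℝ) ^ ((p * t + x.1) % 2) else 1) *
            (if ab.2 then (-1 : ℝ) ^ ((q * t + x.2) % 2) else 1)
        else 0))
    (α β : ℕ → Bool) (i : ℕ) (y : Fin p × Fin q) :
    (2 : ℝ) ^ i * ((((List.range i).map fun j => (α j, β j)).map M).prod (⟨0, hp⟩, ⟨0, hq⟩) y) =
      ∑ T ∈ range (2 ^ i), if (y.1 : ℕ) = p * T / 2 ^ i ∧ (y.2 : ℕ) = q * T / 2 ^ i then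
        ∏ j ∈ range i, ((if α j then (if Nat.testBit (p * T) j then (-1 : ℝ) else 1) else 1) *
          (if β j then (if Nat.testBit (q * T) j then (-1 : ℝ) else 1) else 1)) else 0 := by
  induction i generalizing y with
  | zero =>
    simp only [pow_zero, one_mul, List.range_zero, List.map_nil, List.prod_nil, Matrix.one_apply,
      Finset.range_one, Finset.sum_singleton, mul_zero, Nat.div_one, Finset.range_zero,
      Finset.prod_empty, Prod.ext_iff, Fin.ext_iff, eq_comm]
  | succ i ih =>
    rw [List.range_succ, List.map_append, List.map_append, List.prod_append, List.map_singleton,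
      List.map_singleton, List.prod_singleton, Matrix.mul_apply,
      show (2 : ℝ) ^ (i + 1) = 2 ^ i * 2 from pow_succ 2 i, Finset.mul_sum,
      show Finset.range (2 ^ (i + 1)) = Finset.range (2 ^ i + 2 ^ i) by rw [Nat.two_pow_succ],
      Finset.sum_range_add, ← Finset.sum_add_distrib]
    have hL : ∀ (z : Fin p × Fin q) (m : ℝ), (2 : ℝ) ^ i * 2 *
        ((((List.range i).map fun j => (α j, β j)).map M).prod (⟨0, hp⟩, ⟨0, hq⟩) z * m) =
        (∑ T ∈ range (2 ^ i), if (z.1 : ℕ) = p * T / 2 ^ i ∧ (z.2 : ℕ) = q * T / 2 ^ i then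
          ∏ j ∈ range i, ((if α j then (if Nat.testBit (p * T) j then (-1 : ℝ) else 1) else 1) *
            (if β j then (if Nat.testBit (q * T) j then (-1 : ℝ) else 1) else 1)) else 0) * (2 * m) :=
      fun z m => by rw [← ih z]; ring
    simp_rw [hL, Finset.sum_mul]
    rw [Finset.sum_comm]
    refine Finset.sum_congr rfl fun T hT => ?_
    rw [sum_ite_state (carry_lt hp hT) (carry_lt hq hT), hM]
    dsimp only [Matrix.of_apply]
    rw [Finset.sum_pair (show (0 : ℕ) ≠ 1 by norm_num)]
    have key : ∀ t : ℕ,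
        (∏ j ∈ range i, ((if α j then (if Nat.testBit (p * T) j then (-1 : ℝ) else 1) else 1) *
          (if β j then (if Nat.testBit (q * T) j then (-1 : ℝ) else 1) else 1))) *
          (2 * (if (y.1 : ℕ) = (p * t + p * T / 2 ^ i) / 2 ∧ (y.2 : ℕ) = (q * t + q * T / 2 ^ i) / 2
            then (1 / 2 : ℝ) * (if α i then (-1 : ℝ) ^ ((p * t + p * T / 2 ^ i) % 2) else 1) *
              (if β i then (-1 : ℝ) ^ ((q * t + q * T / 2 ^ i) % 2) else 1) else 0)) =
        (if (y.1 : ℕ) = p * (2 ^ i * t + T) / 2 ^ (i + 1) ∧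
            (y.2 : ℕ) = q * (2 ^ i * t + T) / 2 ^ (i + 1) then
          ∏ j ∈ range (i + 1),
            ((if α j then (if Nat.testBit (p * (2 ^ i * t + T)) j then (-1 : ℝ) else 1) else 1) *
              (if β j then (if Nat.testBit (q * (2 ^ i * t + T)) j then (-1 : ℝ) else 1) else 1))
        else 0) := by
      intro t
      rw [carry_succ, carry_succ]
      by_cases hc :
        (y.1 : ℕ) = (p * t + p * T / 2 ^ i) / 2 ∧ (y.2 : ℕ) = (q * t + q * T / 2 ^ i) / 2
      · rw [if_pos hc, if_pos hc, Finset.prod_range_succ, sign_bit_succ p i t T,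
          sign_bit_succ q i t T]
        rw [Finset.prod_congr rfl fun j hj =>
          show (if α j then (if Nat.testBit (p * (2 ^ i * t + T)) j then (-1 : ℝ) else 1) else 1) *
              (if β j then (if Nat.testBit (q * (2 ^ i * t + T)) j then (-1 : ℝ) else 1) else 1) =
            (if α j then (if Nat.testBit (p * T) j then (-1 : ℝ) else 1) else 1) *
              (if β j then (if Nat.testBit (q * T) j then (-1 : ℝ) else 1) else 1) by
          rw [testBit_mul_block, testBit_mul_block, if_pos (Finset.mem_range.mp hj),
            if_pos (Finset.mem_range.mp hj)]]
        ring
      · rw [if_neg hc, if_neg hc]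
        ring
    rw [mul_add, mul_add, key 0, key 1]
    simp only [mul_zero, zero_add, mul_one]

/-- A sign has absolute value `1`. -/
theorem abs_sign (b : Bool) : |(if b then (-1 : ℝ) else 1)| = 1 := by
  cases b <;> simp

/-- Fibre resummation: if `2^i W_y = Σ_{T<2^i, carries(T) = y} Lo T` and `|G| ≤ 1`, then
`|Σ_{T<2^i} Lo T · G(carries T)| ≤ 2^i Σ_y |W_y|`. -/
theorem abs_sum_fibre_le {p q : ℕ} (hp : 0 < p) (hq : 0 < q) (i : ℕ) (Lo : ℕ → ℝ) (G : ℕ → ℕ → ℝ)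
    (hG : ∀ m m', |G m m'| ≤ 1) (W : Fin p × Fin q → ℝ)
    (hW : ∀ y, (2 : ℝ) ^ i * W y = ∑ T ∈ range (2 ^ i),
      if (y.1 : ℕ) = p * T / 2 ^ i ∧ (y.2 : ℕ) = q * T / 2 ^ i then Lo T else 0) :
    |∑ T ∈ range (2 ^ i), Lo T * G (p * T / 2 ^ i) (q * T / 2 ^ i)| ≤ 2 ^ i * ∑ y, |W y| := by
  have inner : ∀ T ∈ range (2 ^ i), Lo T * G (p * T / 2 ^ i) (q * T / 2 ^ i) = ∑ y : Fin p × Fin q,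
      (if (y.1 : ℕ) = p * T / 2 ^ i ∧ (y.2 : ℕ) = q * T / 2 ^ i then Lo T else 0) * G y.1 y.2 :=
    fun T hT => by rw [sum_ite_state (carry_lt hp hT) (carry_lt hq hT)]
  rw [Finset.sum_congr rfl inner, Finset.sum_comm]
  simp_rw [← Finset.sum_mul, ← hW]
  calc |∑ y : Fin p × Fin q, 2 ^ i * W y * G y.1 y.2|
      ≤ ∑ y : Fin p × Fin q, |2 ^ i * W y * G y.1 y.2| := Finset.abs_sum_le_sum_abs _ _
    _ ≤ ∑ y : Fin p × Fin q, 2 ^ i * |W y| := Finset.sum_le_sum fun y _ => by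
        rw [abs_mul, abs_mul, abs_of_pos (by positivity : (0 : ℝ) < 2 ^ i)]
        exact mul_le_of_le_one_right (by positivity) (hG _ _)
    _ = 2 ^ i * ∑ y, |W y| := by rw [← Finset.mul_sum]

/-- On an aligned block `T = 2^i x + T₀`: the Walsh factors of a mask `C` at positions `< i` read
`r T₀`, those at positions `≥ i` read `r x + ⌊r T₀ / 2^i⌋`. -/
theorem prod_sign_block (r x i T₀ : ℕ) (C : Finset ℕ) :
    ∏ j ∈ C, (if Nat.testBit (r * (x * 2 ^ i + T₀)) j then (-1 : ℝ) else 1) =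
      (∏ j ∈ range i, if j ∈ C then (if Nat.testBit (r * T₀) j then (-1 : ℝ) else 1) else 1) *
        ∏ j ∈ C.filter (fun j => ¬ j < i),
          (if Nat.testBit (r * x + r * T₀ / 2 ^ i) (j - i) then (-1 : ℝ) else 1) := by
  have hj : ∀ j, (if Nat.testBit (r * (x * 2 ^ i + T₀)) j then (-1 : ℝ) else 1) =
      if j < i then (if Nat.testBit (r * T₀) j then (-1 : ℝ) else 1)
      else (if Nat.testBit (r * x + r * T₀ / 2 ^ i) (j - i) then (-1 : ℝ) else 1) := by
    intro j
    rw [mul_comm x, testBit_mul_block]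
    by_cases h : j < i
    · rw [if_pos h, if_pos h]
    · rw [if_neg h, if_neg h]
  rw [Finset.prod_congr rfl fun j _ => hj j, Finset.prod_ite, Finset.prod_ite_mem]
  congr 1
  refine Finset.prod_congr ?_ fun _ _ => rfl
  ext j
  simp only [Finset.mem_filter, Finset.mem_inter, Finset.mem_range]
  tauto

/-- BLOCK BOUND: on an aligned dyadic block `[x 2^i, (x+1) 2^i)` the Walsh–dilation sum of the
masks `A, B ⊆ ℕ` is at most `2^i ‖e₀₀ M_{ℓ₀} ⋯ M_{ℓ_{i-1}}‖₁`, `ℓ_j = (j ∈ A, j ∈ B)`. -/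
theorem abs_block_le {p q : ℕ} (hp : 0 < p) (hq : 0 < q)
    (M : Bool × Bool → Matrix (Fin p × Fin q) (Fin p × Fin q) ℝ)
    (hM : M = fun ab : Bool × Bool => (Matrix.of fun (x y : Fin p × Fin q) =>
      ∑ t ∈ ({0, 1} : Finset ℕ),
        if (y.1 : ℕ) = (p * t + x.1) / 2 ∧ (y.2 : ℕ) = (q * t + x.2) / 2 then
          (1 / 2 : ℝ) * (if ab.1 then (-1 : ℝ) ^ ((p * t + x.1) % 2) else 1) *
            (if ab.2 then (-1 : ℝ) ^ ((q * t + x.2) % 2) else 1)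
        else 0))
    (A B : Finset ℕ) (i x : ℕ) :
    |∑ T ∈ Ico (x * 2 ^ i) ((x + 1) * 2 ^ i), (∏ j ∈ A, (if Nat.testBit (p * T) j then (-1 : ℝ) else 1)) *
        (∏ j ∈ B, (if Nat.testBit (q * T) j then (-1 : ℝ) else 1))| ≤
      2 ^ i * ∑ y : Fin p × Fin q,
        |((((List.range i).map fun j => (decide (j ∈ A), decide (j ∈ B))).map M).prod
          (⟨0, hp⟩, ⟨0, hq⟩) y)| := by
  have hS := two_pow_mul_row_prod hp hq M hM (fun j => decide (j ∈ A)) (fun j => decide (j ∈ B)) i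
  simp only [decide_eq_true_eq] at hS
  rw [Finset.sum_Ico_eq_sum_range, show (x + 1) * 2 ^ i - x * 2 ^ i = 2 ^ i by
    rw [add_mul, one_mul, Nat.add_sub_cancel_left]]
  simp_rw [prod_sign_block]
  have hG : ∀ m m' : ℕ,
      |(∏ j ∈ A.filter (fun j => ¬ j < i), (if Nat.testBit (p * x + m) (j - i) then (-1 : ℝ) else 1)) *
        (∏ j ∈ B.filter (fun j => ¬ j < i),
          (if Nat.testBit (q * x + m') (j - i) then (-1 : ℝ) else 1))| ≤ 1 := fun m m' => by
    rw [abs_mul, Finset.abs_prod, Finset.abs_prod, Finset.prod_eq_one fun j _ => abs_sign _,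
      Finset.prod_eq_one fun j _ => abs_sign _, mul_one]
  refine le_of_eq_of_le (congrArg _ (Finset.sum_congr rfl fun T₀ _ => ?_))
    (abs_sum_fibre_le hp hq i _ _ hG _ hS)
  rw [Finset.prod_mul_distrib]
  ring

/-- The number of twisted letters among the first `i` letters of the word of the masks `A, B`. -/
theorem length_filter_word (A B : Finset ℕ) (i : ℕ) :
    (((List.range i).map fun j => (decide (j ∈ A), decide (j ∈ B))).filter
        (fun ab => ab ≠ (false, false))).length = ((A ∪ B).filter (· < i)).card := by
  rw [List.filter_map, List.length_map, ← List.toFinset_card_of_nodup ((List.nodup_range).filter _),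
    List.toFinset_filter, List.toFinset_range]
  congr 1
  ext j
  simp only [Finset.mem_filter, Finset.mem_range, Finset.mem_union, Function.comp_apply, ne_eq,
    Prod.mk.injEq, decide_eq_false_iff_not, not_and_or, not_not, decide_eq_true_eq]
  tauto

/-- Aligned blocks of `T ↦ f (T + 2^c)` at levels `i ≤ c` are aligned blocks of `f`. -/
theorem blocks_shift (f : ℕ → ℝ) (β : ℕ → ℝ) (c : ℕ)
    (hB : ∀ i x, i ≤ c + 1 → |∑ T ∈ Ico (x * 2 ^ i) ((x + 1) * 2 ^ i), f T| ≤ β i) :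
    ∀ i x, i ≤ c → |∑ T ∈ Ico (x * 2 ^ i) ((x + 1) * 2 ^ i), f (T + 2 ^ c)| ≤ β i := by
  intro i x hi
  obtain ⟨d, rfl⟩ := Nat.exists_eq_add_of_le hi
  rw [Finset.sum_Ico_add' f, show x * 2 ^ i + 2 ^ (i + d) = (x + 2 ^ d) * 2 ^ i by ring,
    show (x + 1) * 2 ^ i + 2 ^ (i + d) = (x + 2 ^ d + 1) * 2 ^ i by ring]
  exact hB i _ (Nat.le_succ_of_le hi)

/-- Prefix intervals `[0, b)`, `b < 2^c`, cost at most one block of each length `2^i`, `i < c`. -/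
theorem abs_sum_prefix_lt (β : ℕ → ℝ) (c : ℕ) : ∀ f : ℕ → ℝ,
    (∀ i x, i ≤ c → |∑ T ∈ Ico (x * 2 ^ i) ((x + 1) * 2 ^ i), f T| ≤ β i) →
    ∀ b, b < 2 ^ c → |∑ T ∈ Ico 0 b, f T| ≤ ∑ i ∈ range c, β i := by
  induction c with
  | zero =>
    intro f _ b hb
    have hb0 : b = 0 := by simpa using hb
    subst hb0
    simp
  | succ c ih =>
    intro f hB b hb
    have hβ : ∀ i ≤ c + 1, 0 ≤ β i := fun i hi => (abs_nonneg _).trans (hB i 0 hi)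
    have hblock : |∑ T ∈ Ico 0 (2 ^ c), f T| ≤ β c := by
      have := hB c 0 (Nat.le_succ c)
      rwa [zero_mul, zero_add, one_mul] at this
    rw [Finset.sum_range_succ]
    rcases lt_trichotomy b (2 ^ c) with hbc | rfl | hbc
    · exact (ih f (fun i x hi => hB i x (Nat.le_succ_of_le hi)) b hbc).trans
        (le_add_of_nonneg_right (hβ c (Nat.le_succ c)))
    · exact hblock.trans (le_add_of_nonneg_left (Finset.sum_nonneg fun i hi =>
        hβ i (by simp only [Finset.mem_range] at hi; omega)))
    · rw [← Finset.sum_Ico_consecutive f (Nat.zero_le _) hbc.le]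
      refine (abs_add_le _ _).trans ?_
      rw [add_comm]
      refine add_le_add ?_ hblock
      have hshift : ∑ T ∈ Ico (2 ^ c) b, f T = ∑ T ∈ Ico 0 (b - 2 ^ c), f (T + 2 ^ c) := by
        rw [Finset.sum_Ico_add' f, zero_add, Nat.sub_add_cancel hbc.le]
      rw [hshift]
      refine ih (fun T => f (T + 2 ^ c)) (blocks_shift f β c hB) (b - 2 ^ c) ?_
      have h2c := Nat.two_pow_succ c
      omega

/-- Prefix intervals `[0, b)`, `b ≤ 2^c`, cost at most one block of each length `2^i`, `i ≤ c`. -/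
theorem abs_sum_prefix_le (β : ℕ → ℝ) (c : ℕ) (f : ℕ → ℝ)
    (hB : ∀ i x, i ≤ c → |∑ T ∈ Ico (x * 2 ^ i) ((x + 1) * 2 ^ i), f T| ≤ β i)
    (b : ℕ) (hb : b ≤ 2 ^ c) : |∑ T ∈ range b, f T| ≤ ∑ i ∈ range (c + 1), β i := by
  have hβ : ∀ i ≤ c, 0 ≤ β i := fun i hi => (abs_nonneg _).trans (hB i 0 hi)
  rw [Finset.sum_range_succ, Finset.range_eq_Ico]
  rcases eq_or_lt_of_le hb with rfl | hlt
  · have := hB c 0 le_rfl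
    rw [zero_mul, zero_add, one_mul] at this
    exact this.trans (le_add_of_nonneg_left (Finset.sum_nonneg fun i hi =>
      hβ i (by simp only [Finset.mem_range] at hi; omega)))
  · exact (abs_sum_prefix_lt β c f hB b hlt).trans (le_add_of_nonneg_right (hβ c le_rfl))

/-- DYADIC COVER: `Ico a b ⊆ [0, 2^c)` costs at most two blocks of each length `2^i`, `i ≤ c`. -/
theorem abs_sum_Ico_le_cover (β : ℕ → ℝ) (c : ℕ) (f : ℕ → ℝ)
    (hB : ∀ i x, i ≤ c → |∑ T ∈ Ico (x * 2 ^ i) ((x + 1) * 2 ^ i), f T| ≤ β i)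
    (a b : ℕ) (hb : b ≤ 2 ^ c) : |∑ T ∈ Ico a b, f T| ≤ 2 * ∑ i ∈ range (c + 1), β i := by
  have hβ : 0 ≤ ∑ i ∈ range (c + 1), β i :=
    Finset.sum_nonneg fun i hi => (abs_nonneg _).trans (hB i 0 (by
      simp only [Finset.mem_range] at hi; omega))
  rcases Nat.lt_or_ge a b with hab | hab
  · rw [Finset.sum_Ico_eq_sub f hab.le]
    calc |∑ T ∈ range b, f T - ∑ T ∈ range a, f T|
        ≤ |∑ T ∈ range b, f T| + |∑ T ∈ range a, f T| := abs_sub _ _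
      _ ≤ ∑ i ∈ range (c + 1), β i + ∑ i ∈ range (c + 1), β i :=
        add_le_add (abs_sum_prefix_le β c f hB b hb) (abs_sum_prefix_le β c f hB a (by omega))
      _ = 2 * ∑ i ∈ range (c + 1), β i := by ring
  · rw [Finset.Ico_eq_empty_of_le hab, Finset.sum_empty, abs_zero]
    positivity

/-- `Σ_{i<n} 2^i = 2^n - 1`. -/
theorem sum_two_pow (n : ℕ) : ∑ i ∈ range n, (2 : ℝ) ^ i = 2 ^ n - 1 := by
  induction n with
  | zero => simp
  | succ n ih => rw [Finset.sum_range_succ, ih, pow_succ]; ring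

/-- WORD DECAY ⇒ WALSH–DILATION DECAY (stub `stub_dwdOfWords` of the crux, line `Sketch`): if every
word of pair-carry transfer matrices with at least `w` twisted letters maps `e₀₀` to a vector of
`ℓ¹`-norm `≤ δ`, then the Walsh–dilation sums of masks `A, B ⊆ Fin c` with `|A ∪ B|` large are
`≤ δ 2^c`, uniformly over the intervals `Ico a b ⊆ [0, 2^c)`.  Proof: dyadic cover of `Ico a b`
(≤ 2 blocks per length); a block of length `2^i` costs `≤ 2^i` (used for `i < i₀`) and
`≤ 2^i ‖e₀₀ W_i‖₁ ≤ 2^i δ/8` once its prefix word `W_i` has `≥ w'` twisted letters (`i ≥ i₀`). -/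
theorem stub_dwdOfWords :
    ∀ p q : ℕ, ∀ hp : p.Prime, ∀ hq : q.Prime, p ≠ q → 2 < p → 2 < q →
      (∀ δ : ℝ, 0 < δ → ∃ w : ℕ, ∀ word : List (Bool × Bool),
        w ≤ (word.filter (fun ab => ab ≠ (false, false))).length →
        ∑ y : Fin p × Fin q,
          |((word.map (fun ab : Bool × Bool =>
            (Matrix.of fun (x y : Fin p × Fin q) =>
              ∑ t ∈ ({0, 1} : Finset ℕ),
                if (y.1 : ℕ) = (p * t + x.1) / 2 ∧ (y.2 : ℕ) = (q * t + x.2) / 2 then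
                  (1 / 2 : ℝ) * (if ab.1 then (-1 : ℝ) ^ ((p * t + x.1) % 2) else 1) *
                    (if ab.2 then (-1 : ℝ) ^ ((q * t + x.2) % 2) else 1)
                else 0))).prod)
            (⟨0, hp.pos⟩, ⟨0, hq.pos⟩) y| ≤ δ) →
      (∀ δ : ℝ, 0 < δ → ∃ w : ℕ, ∀ c : ℕ, ∀ A B : Finset (Fin c), w ≤ (A ∪ B).card →
        ∀ a b : ℕ, b ≤ 2 ^ c →
          |∑ T ∈ Ico a b, (∏ i ∈ A, (if Nat.testBit (p * T) i then (-1 : ℝ) else 1)) *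
              (∏ i ∈ B, (if Nat.testBit (q * T) i then (-1 : ℝ) else 1))| ≤ δ * (2 : ℝ) ^ c) := by
  intro p q hp hq _ _ _ hW δ hδ
  obtain ⟨w', hw'⟩ := hW (δ / 8) (by positivity)
  obtain ⟨g, hg⟩ := pow_unbounded_of_one_lt (8 / δ) (one_lt_two : (1 : ℝ) < 2)
  refine ⟨w' + g, fun c A B hcard a b hb => ?_⟩
  set A' : Finset ℕ := A.map Fin.valEmbedding with hA'
  set B' : Finset ℕ := B.map Fin.valEmbedding with hB'
  have hf : ∀ T : ℕ, (∏ i ∈ A, (if Nat.testBit (p * T) i then (-1 : ℝ) else 1)) *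
      (∏ i ∈ B, (if Nat.testBit (q * T) i then (-1 : ℝ) else 1)) =
      (∏ j ∈ A', (if Nat.testBit (p * T) j then (-1 : ℝ) else 1)) *
        (∏ j ∈ B', (if Nat.testBit (q * T) j then (-1 : ℝ) else 1)) := fun T => by
    rw [hA', hB', Finset.prod_map, Finset.prod_map]
    rfl
  simp_rw [hf]
  have hnc : (A ∪ B).card ≤ c := by simpa using Finset.card_le_univ (A ∪ B)
  have hn' : (A' ∪ B').card = (A ∪ B).card := by
    rw [hA', hB', ← Finset.map_union, Finset.card_map]
  have hlt : ∀ j ∈ A' ∪ B', j < c := by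
    intro j hj
    rw [hA', hB', ← Finset.map_union, Finset.mem_map] at hj
    obtain ⟨k, -, rfl⟩ := hj
    exact k.isLt
  have hf1 : ∀ T : ℕ, |(∏ j ∈ A', (if Nat.testBit (p * T) j then (-1 : ℝ) else 1)) *
      (∏ j ∈ B', (if Nat.testBit (q * T) j then (-1 : ℝ) else 1))| = 1 := fun T => by
    rw [abs_mul, Finset.abs_prod, Finset.abs_prod, Finset.prod_eq_one fun j _ => abs_sign _,
      Finset.prod_eq_one fun j _ => abs_sign _, mul_one]
  set n := (A ∪ B).card with hn
  set i₀ : ℕ := c + w' - n with hi₀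
  have hB : ∀ i x, i ≤ c → |∑ T ∈ Ico (x * 2 ^ i) ((x + 1) * 2 ^ i),
      (∏ j ∈ A', (if Nat.testBit (p * T) j then (-1 : ℝ) else 1)) *
        (∏ j ∈ B', (if Nat.testBit (q * T) j then (-1 : ℝ) else 1))| ≤
      (if i < i₀ then (2 : ℝ) ^ i else 0) + δ / 8 * 2 ^ i := by
    intro i x hi
    by_cases hii : i < i₀
    · rw [if_pos hii]
      calc _ ≤ _ := Finset.abs_sum_le_sum_abs _ _
        _ = (2 : ℝ) ^ i := by
          rw [Finset.sum_congr rfl fun T _ => hf1 T, Finset.sum_const, Nat.card_Ico, nsmul_eq_mul,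
            mul_one, show (x + 1) * 2 ^ i - x * 2 ^ i = 2 ^ i by
              rw [add_mul, one_mul, Nat.add_sub_cancel_left], Nat.cast_pow, Nat.cast_ofNat]
        _ ≤ (2 : ℝ) ^ i + δ / 8 * 2 ^ i := le_add_of_nonneg_right (by positivity)
    · rw [if_neg hii, zero_add]
      have hcount : w' ≤ ((((List.range i).map fun j => (decide (j ∈ A'), decide (j ∈ B'))).filter
          (fun ab => ab ≠ (false, false))).length) := by
        rw [length_filter_word]
        have h1 := Finset.card_filter_add_card_filter_not (s := A' ∪ B') (fun j => j < i)
        have h2 : ((A' ∪ B').filter (fun j => ¬ j < i)).card ≤ c - i :=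
          (Finset.card_le_card fun j hj => Finset.mem_Ico.mpr
            ⟨not_lt.mp (Finset.mem_filter.mp hj).2, hlt j (Finset.mem_filter.mp hj).1⟩).trans
            (Nat.card_Ico i c).le
        omega
      calc _ ≤ _ := abs_block_le hp.pos hq.pos _ rfl A' B' i x
        _ ≤ 2 ^ i * (δ / 8) := by
            gcongr
            exact hw' _ hcount
        _ = δ / 8 * 2 ^ i := by ring
  have hcov := abs_sum_Ico_le_cover _ c _ hB a b hb
  rw [Finset.sum_add_distrib] at hcov
  have hsum1 : ∑ i ∈ range (c + 1), (if i < i₀ then (2 : ℝ) ^ i else 0) ≤ 2 ^ i₀ := by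
    rw [← Finset.sum_filter, show (range (c + 1)).filter (· < i₀) = range i₀ by
      ext j; simp only [Finset.mem_filter, Finset.mem_range]; omega, sum_two_pow]
    linarith
  have hsum2 : ∑ i ∈ range (c + 1), δ / 8 * (2 : ℝ) ^ i ≤ δ / 4 * 2 ^ c := by
    rw [← Finset.mul_sum, sum_two_pow, pow_succ]
    nlinarith
  have hsmall : (2 : ℝ) ^ i₀ ≤ δ / 8 * 2 ^ c := by
    have h1 : (2 : ℝ) ^ i₀ * 2 ^ g ≤ 2 ^ c := by
      rw [← pow_add]; exact pow_le_pow_right₀ one_le_two (by omega)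
    nlinarith [mul_le_mul_of_nonneg_left h1 hδ.le, mul_lt_mul_of_pos_left ((div_lt_iff₀ hδ).mp hg)
      (by positivity : (0 : ℝ) < 2 ^ i₀)]
  have h2c : (0 : ℝ) ≤ δ * 2 ^ c := by positivity
  linarith

end Summit.QuantumAdvantage.QuantumAdvantage.Theorems.MobiusLadderQuadraticDigitPhasesStubDwdOfWords
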